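import Summits.AtomisticToContinuum.BoseEinsteinCondensation.Theorems.PeriodicIRBound.Negative.GroundOccupation

/-!
# Line `fsum-phase-pencil` — crux `BECGroundStateSOS.PeriodicIRBound` (stmt-AtomisticToContinuum-3972)
· skeleton, crux-plan round 1 (idea card `Ideas/fsum-phase-pencil.md`, ideator 2; triage r1-1/2/3: pass ×3,
merged with `backflow-susceptibility`)

**The crux** (fixed; `Theses.BECGroundStateSOS.PeriodicIRBound`, unfolded by the landed
`Negative.periodicIRBound_iff` into `∀ v admissible, IRBoundFor v`): the T = 0 infrared bound
`n_k(Ψ) ≤ C√ρ L_N/‖k‖_∞` for `δ`-near-minimisers (`δ` AFTER `N`) of the periodic `N`-body energy on the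
torus `L_N = (N/ρ)^{1/3}`, every mode `0 < ‖k‖_∞ ≤ κ√ρ L_N`, all `ρ < ρ₀(v, κ)`, eventually in `N`.

**The line (one paragraph).** Two generators per mode, in FIRST quantisation over the tree's `C¹`
periodic states: the density wave `ρ_k†Ψ = (∑ⱼ e_k(xⱼ))Ψ` (a multiplication operator, so `[V, ρ_k†] = 0`
and its `(H−E₀)`-weight is the f-sum rule `N‖k̃‖²`, `k̃ = 2πk/L`) and the number-conserving condensate
PHASE transfer `U_k Ψ = (a_k†a₀ − a₀†a₋ₖ)Ψ` (`phaseUp`, via the one-body lift `transfer`). The kinetic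
commutator splits EXACTLY as `W_k := [T, ρ_k†] = ‖k̃‖² U_k + R_k` (`kinCommutator`; the two condensate
legs `p ∈ {0, −k}` of `∑_p (2p·k̃ + ‖k̃‖²) a†_{p+k}a_p` are `‖k̃‖² U_k`, the rest `R_k = ‖k̃‖ J′_k` is the
longitudinal current of the NON-condensate cloud). Cauchy–Schwarz in the non-negative form `H − E₀` for the
pair `(ρ_k†Ψ, U_kΨ)` (one `2×2` block of the route's ground-state cone) therefore reads
`(‖k̃‖²‖U_kΨ‖² + β_k)² ≤ F·𝒴`, `F ≤ 2N‖k̃‖²` (f-sum), `𝒴 = Q(U_kΨ)` (a double commutator, `≲ N(‖k̃‖²+ρ)`),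
`β_k = Re⟨U_kΨ, R_kΨ⟩` (BACKFLOW); a quadratic inequality then gives the n₀-WEIGHTED infrared bound
`‖U_kΨ‖² ≲ N(1 + √ρ/‖k̃‖) ≲ N√ρL/‖k‖_∞` at O(1) precision in every input (`weighted_algebra`, proved). With
the mirror quadrature `P_k = a_k†a₀ + a₀†a₋ₖ` (`condUp`), `‖U_kΨ‖² + ‖P_kΨ‖² = 2⟨n₀(n_k+1)⟩ + 2⟨n₋ₖ(n₀+1)⟩`
(parallelogram law), so the weighted bound is a bound on `⟨n₀ n_k⟩`; the normalisation `⟨n₀n_k⟩ ↦ n_k`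
is a bootstrap (weighted mode counting + no-cat + coupling continuity, `δ` after `N`).

**Registered stubs (7; sizes; the ONLY `sorry`s of the file):**
* S1 `stub_backflowBound` — `BackflowBound` (XL, HARDEST, the load): `|β_k| ≤ C(N√ρ‖k̃‖ + √N‖k̃‖²‖U_kΨ‖)`,
  the weakest form digestible by the composition (implied by the static current bound
  `‖R_kΨ‖² ≤ C N‖k̃‖⁴` via Cauchy–Schwarz, AND by the pure correlation bound `|β_k| ≤ C N√ρ‖k̃‖`).
* S2 `stub_phaseConeBlock` — `PhaseConeBlock` (M–L, provable now): cone Cauchy–Schwarz + f-sum + near-min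
  defect control, at general `(N, L)`: `|Re⟨U_kΨ, W_kΨ⟩| ≤ √(Q(U_kΨ)·(2N‖k̃‖² + ε)) + ε`.
* S3 `stub_phaseDoubleCommutator` — `PhaseDoubleCommutator` (M–L): `Q(U_kΨ) ≤ C N(‖k̃‖² + ρ) + ε`.
* S4 `stub_condensateDensityQuadrature` — `CondensateDensityQuadrature` (L–XL): `‖P_kΨ‖² ≤ C N + ε`
  (the condensate-leg density quadrature is not enhanced; mirror pencil `{P_k, U_k}` in the docstring).
* S5a `stub_condensateNumberVariance` — `CondensateNumberVariance` (XL, open "no cat"): `Var_Ψ(n̂₀) ≤ C N`.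
* S5 `stub_normalisationBootstrap` — `NormalisationBootstrap` (L): no-cat + weighted class bound ⇒
  `IRBoundFor w` for every `w` of the class (weighted mode counting, dichotomy, coupling continuity, Chebyshev).
* S6 `stub_nonIntegrableHalf` — `NonIntegrableHalf` (XL, NOT REDUCED here): the crux on `{∫v = ∞}`
  (hard cores) — needs the Jastrow/Dyson-DRESSED pencil; shared debt with stmt-11844 / GDTransfer.
Composition (sorry-free): `weighted_algebra` (real algebra, quadratic inequality), `weightedClassBound_of`
(S1–S4 ⇒ `WeightedClassBound R₀ V₁` for every class `𝒱(R₀, V₁)`, with the defect allowances chosen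
`ε₁ = N√ρ‖k̃‖, ε₂ = N‖k̃‖², ε₃ = Nρ, ε₄ = N` and absorbed by the window inequalities
`1 ≤ κ√ρL/‖k‖_∞`, `√ρ/‖k̃‖ ≤ √ρL/(2π‖k‖_∞)`), `irBoundFor_all` (S5a, S5 on the integrable class, S6 off
it), `PeriodicIRBound_of` / `PeriodicIRBound_proof` (conclude the crux BY NAME through
`Negative.periodicIRBound_iff`).

**Potential classes.** S1, S3, S4, S5a are stated UNIFORMLY over `𝒱(R₀, V₁) = {w measurable, range ≤ R₀,
∫w(|x|)dx ≤ V₁}` (`InClass`) with the `∀ w` INSIDE `∀ᶠ N` (constants and `N`-threshold depend on `R₀, V₁, κ`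
only): this is exactly what the coupling-continuity bootstrap of S5 needs (`λw ∈ 𝒱` for `λ ≤ 1`, `0 ∈ 𝒱`),
and every integrable admissible `v` lies in `𝒱(max R₀ 1, ∫v)`. Constants of the UNDRESSED pencil grow with
`V₁ = ∫v` (Born level), which is why `{∫v = ∞}` is a separate half (S6, `Negative`-style split
`Disproof.periodicIRBound_iff_split`).

**Disproof.lean honoured** (cycles 1–2, §1–§19, read 2026-08-16): §5 `periodicIRBound_false_without_nearMin`
— the near-minimiser property enters every analytic stub, as "`∀ ε ∃ δ` (after `N`, `k`)" = positivity of
`H − E₀` on the state's own sector plus `O(√δ)` defects (S2 is where it is USED: Cauchy–Schwarz in the form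
`H − E₀ ≥ 0`); §8 `periodicIRBound_false_uniformSlack` — `δ` is chosen after `N` (and after `k`, `ε`)
everywhere, the §3 two-mode states are not `δ`-near-minimisers for small `δ`; §6 finite range kept in
`InClass`/`IsRepulsiveFiniteRange`; §7 `ρ < ρ₀` kept; §9 free gas: `0 ∈ 𝒱(R₀,V₁)` and every stub is exact or
trivially true there (`R_kΨ₀ = 0`, `Q(U_kΨ₀) = N‖k̃‖²`, `‖P_kΨ₀‖² = N`, `Var n₀ = 0`); §11 `irBoundFor_iff_ground`:
the "`∀ε ∃δ`" frame is the `γ_N(k)` reading; §12 `k ≠ 0` via `InWindow`; §13 scaling: `C ∝ √a` is carried by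
the `√ρ`-terms of S1/S3; §16 the final slack is whatever S5 extracts (expected `≍ C√ρ/L_N`); §19
`hardCore_in_scope`/`periodicIRBound_iff_split`: S6 is that half, flagged NOT reduced. Landed Negative lemmas
(`Theorems/PeriodicIRBound/Negative/{TwoModeStates,LoadBearing,FreeGas,GroundOccupation,Scaling}`, imported
here): each refutes a VARIANT of the crux (no near-min / no finite range / all densities / uniform slack /
with `k = 0`); no stub is an instance — S1–S5a are not infrared-bound statements at all, S5/S6 conclude the
crux's own `IRBoundFor` (near-min, `δ` after `N`, `ρ < ρ₀`, `k ≠ 0`, finite range).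

**For stub workers.** `Lines/` files are never imported: copy the VOCABULARY block (§ Vocabulary) and the
named statement verbatim into your `Theorems/` file (same `open`s), prove `theorem stub_<name> : <Name>`.
-/

noncomputable section

open MeasureTheory Filter
open scoped ENNReal NNReal ComplexConjugate BigOperators

namespace Summit.AtomisticToContinuum.BoseEinsteinCondensation.Cruxes.PeriodicIRBound.FsumPhasePencil

open Literature.MathematicalPhysics.QuantumManyBody.BoseGas
open Summit.AtomisticToContinuum.BoseEinsteinCondensation.Theses.BECGroundStateSOS (PeriodicIRBound)
open Summit.AtomisticToContinuum.BoseEinsteinCondensation.Theorems.PeriodicIRBound.Negative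
  (NearMin InWindow IRIneq IRBoundFor periodicIRBound_iff)
open Summit.AtomisticToContinuum.BoseEinsteinCondensation.Theorems.GaussianDominationCan.Negative
  (one_le_norm_intVec)

/-! ## Vocabulary (all over tree declarations; copy this block verbatim into a `Theorems/` file) -/

section Vocabulary

variable {N : ℕ}

/-- The wave vector `k̃ = 2πk/L ∈ ℝ³` of the integer mode `k ∈ ℤ³` (`‖k̃‖ = 2π|k|₂/L`). -/
def waveVec (L : ℝ) (k : Fin 3 → ℤ) : Space :=
  (2 * Real.pi / L) • latticeVec 1 k

/-- The one-body lift `dΓ(|φ_a⟩⟨φ_b|)Ψ = a†(φ_a) a(φ_b) Ψ` in first quantisation, `φ_c = L^{-3/2} e_c`: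
`X ↦ ∑ⱼ L⁻³ e_a(xⱼ) ∫_cell conj(e_b(y)) Ψ(X[j ↦ y]) dy`. On a one-particle plane wave `e_p`:
`transfer a b e_p = δ_{b,p} e_a`. -/
def transfer (L : ℝ) (a b : Fin 3 → ℤ) (Ψ : Config N → ℂ) (X : Config N) : ℂ :=
  ∑ j : Fin N, (((L ^ 3)⁻¹ : ℝ) : ℂ) * cellWave L a (X j) *
    ∫ y in cell L, (starRingEnd ℂ) (cellWave L b y) * Ψ (Function.update X j y)

/-- The condensate PHASE-transfer quadrature (raising by `k`) `U_k Ψ = (a_k† a₀ − a₀† a₋ₖ) Ψ`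
(`= Y_k†Ψ` of the idea card). `‖U_kΨ‖² = ⟨n₀(n_k+1)⟩ + ⟨n₋ₖ(n₀+1)⟩ − 2Re⟨a₀†a₀†a_ka₋ₖ⟩`
(Bogoliubov: `N₀(u_k+v_k)² = N₀√(‖k̃‖²+2B)/‖k̃‖`, the LARGE quadrature). -/
def phaseUp (L : ℝ) (k : Fin 3 → ℤ) (Ψ : Config N → ℂ) (X : Config N) : ℂ :=
  transfer L k 0 Ψ X - transfer L 0 (-k) Ψ X

/-- The condensate DENSITY-transfer quadrature (raising by `k`) `P_k Ψ = (a_k† a₀ + a₀† a₋ₖ) Ψ`, the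
condensate-leg part of `ρ_k† = ∑_p a†_{p+k} a_p` (`= X_k†Ψ` of the idea card).
`‖U_kΨ‖² + ‖P_kΨ‖² = 2⟨n₀(n_k+1)⟩ + 2⟨n₋ₖ(n₀+1)⟩` (parallelogram law; Bogoliubov `‖P_kΨ‖² = N₀(u−v)²
= N₀‖k̃‖/√(‖k̃‖²+2B) ≤ N₀`, the SMALL quadrature). -/
def condUp (L : ℝ) (k : Fin 3 → ℤ) (Ψ : Config N → ℂ) (X : Config N) : ℂ :=
  transfer L k 0 Ψ X + transfer L 0 (-k) Ψ X

/-- The kinetic commutator `W_k Ψ = [T, ρ_k†]Ψ = ∑ⱼ e_k(xⱼ) (‖k̃‖² Ψ − 2i ∂_{xⱼ·k̃} Ψ)` (`T = −∑Δⱼ`,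
`ρ_k† = ∑ⱼ e_k(xⱼ)` commutes with the interaction; only FIRST derivatives of the `C¹` state enter). On
`e_p`: `W_k e_p = (‖k̃‖² + 2k̃·p̃) e_{p+k}`, so `W_k = ‖k̃‖² U_k + R_k` with `R_k` KILLING the condensate legs
`p ∈ {0, −k}` (the card's `‖k̃‖·J′_k`). For an eigenstate, `W_kΨ₀ = (H − E₀)(ρ_k†Ψ₀)`. -/
def kinCommutator (L : ℝ) (k : Fin 3 → ℤ) (Ψ : Config N → ℂ) (X : Config N) : ℂ :=
  ∑ j : Fin N, cellWave L k (X j) *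
    (((‖waveVec L k‖ ^ 2 : ℝ) : ℂ) * Ψ X - 2 * Complex.I * fderiv ℝ Ψ X (Pi.single j (waveVec L k)))

/-- `‖f‖²` on the fundamental cell `[0,L)^{3N}`. -/
def cellNormSq (L : ℝ) (f : Config N → ℂ) : ℝ :=
  ∫ X in cellN N L, ‖f X‖ ^ 2

/-- `Re⟨f, g⟩` on the fundamental cell. -/
def cellInnerRe (L : ℝ) (f g : Config N → ℂ) : ℝ :=
  (∫ X in cellN N L, (starRingEnd ℂ) (f X) * g X).re

/-- The energy form `Q_E(f) = ⟨f, (H − E)f⟩ = ∫_cell (|∇f|² + (V − E)|f|²)` of a (not normalised) function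
on the cell, `V = ∑_{i<j} w^per(xᵢ − xⱼ)`, as a real number (Bochner; integrable for `C¹` periodic `f` and
`∫w < ∞`). With `E = E₀^per` it is `≥ 0` on Bose-symmetric periodic `C¹` functions (variational principle). -/
def energyForm (w : ℝ → ℝ≥0∞) (L : ℝ) (E : ℝ) (f : Config N → ℂ) : ℝ :=
  ∫ X in cellN N L, ((kineticDensity f X).toReal + ((periodicInteraction w L X).toReal - E) * ‖f X‖ ^ 2)

/-- The potential class `𝒱(R₀, V₁)`: measurable radial profile, range `≤ R₀`, `∫_{ℝ³} w(|x|) dx ≤ V₁`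
(hard cores excluded; `0 ∈ 𝒱`; `λw ∈ 𝒱` for `λ ≤ 1`; an admissible integrable `v` lies in `𝒱(max R₀ 1, ∫v)`). -/
def InClass (R₀ V₁ : ℝ) (w : ℝ → ℝ≥0∞) : Prop :=
  Measurable w ∧ (∀ r, R₀ < r → w r = 0) ∧ (∫⁻ x : Space, w ‖x‖) ≤ ENNReal.ofReal V₁

end Vocabulary

/-! ## The named statements of the line -/

/-- **S1 — BACKFLOW BOUND (the load; XL; registered `stub_backflowBound`, the HARDEST stub).**
For every class `𝒱(R₀,V₁)` and window `κ` there are `ρ₀, C` such that for `ρ < ρ₀`, eventually in `N`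
(uniformly over the class), for every window mode and every `ε > 0` there is `δ > 0` with: for every
`δ`-near-minimiser `Ψ`,
`|β_k(Ψ)| ≤ C·(N√ρ‖k̃‖ + √N ‖k̃‖² ‖U_kΨ‖) + ε`, where
`β_k(Ψ) := Re⟨U_kΨ, W_kΨ⟩ − ‖k̃‖²‖U_kΨ‖² = Re⟨U_kΨ, R_kΨ⟩` is the correlation of the condensate phase
quadrature with the NON-condensate longitudinal current `R_k = W_k − ‖k̃‖²U_k = ‖k̃‖J′_k`
(`J′_k = ∑_{p ∉ {0,−k}} (2p·k̂ + ‖k̃‖) a†_{p+k}a_p`). This hybrid is the WEAKEST hypothesis the composition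
digests; it is implied (i) by the STATIC current bound `‖R_kΨ‖² ≤ C N ‖k̃‖⁴` (Cauchy–Schwarz ⇒ the second
term; "the cloud's longitudinal current fluctuation is extensive and `O(‖k̃‖²)`", exact zero `J′_0Ψ₀ =
2k̂·P_totΨ₀ = 0`; triage r1-2 sharpening) and (ii) by the pure CORRELATION bound `|β_k| ≤ C N√ρ‖k̃‖` (the
card's (B1): `cos∠(J′_kΨ₀, Y_kΨ₀) ≲ (‖k̃‖ξ/√(ρa³))^{1/2}`). Heuristics: free gas `R_kΨ₀ = 0` (exact);
Bogoliubov `‖R_kΨ₀‖² = ‖k̃‖²⟨J′†J′⟩ ≈ 1.4·N√(ρa³)‖k̃‖⁴` (triage r1-2 §J-C: the normal and anomalous Wick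
contractions cancel to `O(k²)` by antisymmetry of `(2p·k̂+k)(u_{p+k}v_p − u_pv_{p+k})`), i.e. (i) holds with
room `1/(a‖k̃‖)`; any extensive QUADRATIC bound `‖J′_kΨ₀‖² ≤ C N‖k̃‖²` (equivalently `‖R_kΨ₀‖² ≤ C N‖k̃‖⁴`,
ANY `C`) suffices: the composition's quadratic inequality absorbs it into `‖U_kΨ‖² ≤ 2CN + …`, and the window
`1 ≤ κ√ρL/‖k‖_∞` turns `O(N)` into the crux's shape. Why it might fail: the `O(k²)` is a cancellation, to be held non-perturbatively and
uniformly down to `‖k̃‖ = 2π/L` (a Lipschitz modulus of continuity of `k ↦ J′_kΨ₀` at `k = 0`); a soft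
mode coupling the cloud current to the phase direction, or `‖J′_kΨ₀‖² ≍ N²` (no clustering), kills it.
Barrier: `BogoliubovPerturbationInfraredNarrow` conjunct (2) (derivative vertex, one soft leg: IR-finite at
one loop in `d = 3`) is the favourable class; the bet is that it holds as a bound. Leans on: the vocabulary;
`LSSY2005_upperBound_periodic_holds` / the Hartree bound `E₀ ≤ ½NρV₁` for a priori kinetic bounds;
`HasTotalMomentum` (`PeriodicBoseGasMomentumSector`) for `P_totΨ₀ = 0`. -/
def BackflowBound : Prop :=
  ∀ R₀ V₁ : ℝ, 0 < R₀ → 0 ≤ V₁ → ∀ κ : ℝ, 0 < κ →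
    ∃ ρ₀ : ℝ, 0 < ρ₀ ∧ ∃ C : ℝ, 0 < C ∧ ∀ ρ : ℝ, 0 < ρ → ρ < ρ₀ → ∀ᶠ N : ℕ in atTop,
      ∀ w : ℝ → ℝ≥0∞, InClass R₀ V₁ w →
        periodicGroundStateEnergy w N (sideLength ρ N) ≠ ⊤ →
        ∀ k : Fin 3 → ℤ, InWindow κ ρ N k → ∀ ε : ℝ, 0 < ε → ∃ δ : ℝ≥0∞, 0 < δ ∧
          ∀ Ψ : PeriodicTrialState N (sideLength ρ N), NearMin w ρ N δ Ψ →
            |cellInnerRe (sideLength ρ N) (phaseUp (sideLength ρ N) k Ψ.ψ)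
                  (kinCommutator (sideLength ρ N) k Ψ.ψ) -
                ‖waveVec (sideLength ρ N) k‖ ^ 2 *
                  cellNormSq (sideLength ρ N) (phaseUp (sideLength ρ N) k Ψ.ψ)| ≤
              C * (N * Real.sqrt ρ * ‖waveVec (sideLength ρ N) k‖ +
                    Real.sqrt N * ‖waveVec (sideLength ρ N) k‖ ^ 2 *
                      Real.sqrt (cellNormSq (sideLength ρ N) (phaseUp (sideLength ρ N) k Ψ.ψ))) + ε

/-- **S2 — PHASE CONE BLOCK (M–L, provable now; registered `stub_phaseConeBlock`).** At GENERAL `(N, L)`,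
for admissible integrable `w` with `E₀^per < ∞`, every `k ≠ 0` and `ε > 0` there is `δ > 0` such that every
`δ`-near-minimiser `Ψ` satisfies
`|Re⟨U_kΨ, W_kΨ⟩| ≤ √( Q_{E₀}(U_kΨ) · (2N‖k̃‖² + ε) ) + ε`.
Content (three textbook identities + defect control): (a) `U_kΨ` and `ρ_{±k}†Ψ` are `C¹`, `Lℤ³`-periodic,
Bose-symmetric, so `Q_{E₀} ≥ 0` on them and on their sums (variational principle after normalisation,
`PeriodicTrialState` constructor) ⇒ Cauchy–Schwarz `|Re B(U_kΨ, ρ_k†Ψ)|² ≤ Q(U_kΨ)·Q(ρ_k†Ψ)` for the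
polar form `B` of `Q_{E₀}`; (b) f-sum: for a smooth multiplier `G = ∑ⱼ e_k(xⱼ)`,
`Q(GΨ) + Q(ḠΨ) = 2∫|∇G|²|Ψ|² + 2Re B(|G|²Ψ, Ψ)` with `|∇G|² = N‖k̃‖²` pointwise and
`|Re B(|G|²Ψ,Ψ)| ≤ √(Q(|G|²Ψ))·√(Q(Ψ))`, `Q(Ψ) = ⟨Ψ,HΨ⟩ − E₀ ≤ δ`, whence
`Q(ρ_k†Ψ) ≤ 2N‖k̃‖² + (defect → 0 as δ → 0 at fixed N, L, k)` (the partner `Q(ρ₋ₖ†Ψ) ≥ 0` is dropped: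
no inversion symmetry of `Ψ` is assumed, the price is the factor `2`); (c) `B(U_kΨ, ρ_k†Ψ) =
⟨U_kΨ, W_kΨ⟩ + B(ḠU_kΨ, Ψ)` (one periodic integration by parts, `integral_cell_fderiv_eq_zero`; the last
term is again `≤ √(Q(ḠU_kΨ))√δ`). All defects are `≤ C(N, L, k, w)√δ` because `U_kΨ`, `|G|²Ψ` have energy
forms bounded in terms of `⟨Ψ,HΨ⟩ ≤ E₀ + δ` (smoothing bound `|U_iΨ|² ≤ 4L⁻³∫_cell|Ψ(X[i↦y])|²dy`).
Free gas: `Re⟨U_kΨ₀,W_kΨ₀⟩ = N‖k̃‖² = √(Q(U_kΨ₀)·N‖k̃‖²)` (saturated up to the factor `2`). Why it might fail: it cannot (finite-dimensional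
linear algebra + calculus on the torus); size is the Lean work (parametric integrals, IBP). Leans on:
`integral_cell_fderiv_eq_zero`, `hasFDerivAt_cellWave`, `fderiv_cellWave_apply_single`, `contDiff_cellWave`,
`cellWave_periodic`, `periodicGroundStateEnergy_le`, `PeriodicTrialState` API (`PeriodicBoseGasFourier`,
`GroundStateDirichletForm` patterns). -/
def PhaseConeBlock : Prop :=
  ∀ w : ℝ → ℝ≥0∞, IsRepulsiveFiniteRange w → (∫⁻ x : Space, w ‖x‖) ≠ ⊤ →
    ∀ (N : ℕ) (L : ℝ), 0 < L → periodicGroundStateEnergy w N L ≠ ⊤ →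
      ∀ k : Fin 3 → ℤ, k ≠ 0 → ∀ ε : ℝ, 0 < ε → ∃ δ : ℝ≥0∞, 0 < δ ∧
        ∀ Ψ : PeriodicTrialState N L, periodicEnergy w Ψ ≤ periodicGroundStateEnergy w N L + δ →
          |cellInnerRe L (phaseUp L k Ψ.ψ) (kinCommutator L k Ψ.ψ)| ≤
            Real.sqrt (energyForm w L (periodicGroundStateEnergy w N L).toReal (phaseUp L k Ψ.ψ) *
                (2 * N * ‖waveVec L k‖ ^ 2 + ε)) + ε

/-- **S3 — PHASE DOUBLE COMMUTATOR (M–L; registered `stub_phaseDoubleCommutator`).** Uniformly over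
`𝒱(R₀,V₁)`: `Q_{E₀}(U_kΨ) ≤ C·N·(‖k̃‖² + ρ) + ε` for `δ`-near-minimisers (`δ` after `N, k, ε`).
Content: symmetrise with the partner `U_k† = −U₋ₖ`:
`Q(U_kΨ) ≤ Q(U_kΨ) + Q(U₋ₖΨ) = ⟨[U_k†,[H,U_k]]⟩_Ψ + Re(⟨U_k†U_kΨ,(H−E₀)Ψ⟩ + ⟨(H−E₀)Ψ, U_kU_k†Ψ⟩)`
(defects `≤ C√δ` as in S2). Kinetic part: `[T, U_k] = ‖k̃‖² P_k`, `[U_k†, P_k] = 2n̂₀ − n̂_k − n̂₋ₖ`, so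
`½⟨[U†,[T,U]]⟩ ≤ ‖k̃‖² N`. Interaction part: `[U_k†,[V,U_k]]` is a two-body operator
`∑_{i≠j}[𝔭ᵢ† + 𝔭ⱼ†, [w_ij, 𝔭ᵢ + 𝔭ⱼ]]` (`𝔭 = |φ_k⟩⟨φ₀| − |φ₀⟩⟨φ₋ₖ|`); every term is an integral of
`w^per(xᵢ−xⱼ)` against products of `Ψ` and cell-averages of `Ψ` in ONE variable, and the smoothing bound
`|𝔭ᵢΨ|² ≤ 4L⁻³∫_cell|Ψ(X[i↦y])|²dy` makes each `∫w(xᵢ−xⱼ)|𝔭ᵢΨ|² ≤ 4L⁻³∫w` STATE-INDEPENDENT; cross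
terms `⟨w_ijΨ, 𝔭ᵢ𝔭ⱼΨ⟩` are Cauchy–Schwarz'd against `⟨V⟩_Ψ ≤ ⟨Ψ,HΨ⟩ ≤ E₀ + δ ≤ ½NρV₁ + δ` (constant trial
state: `E₀^per ≤ N(N−1)∫w/(2L³)`). Total `≤ 2N‖k̃‖² + C′NρV₁`, `C = max(2, C′V₁)`. Free gas: `Q(U_kΨ₀) =
N‖k̃‖²`. Bogoliubov: `N₀(‖k̃‖² + 2B)`, `B ≈ 8πρa`. Why it might fail: it is an EXPECTATION (not a norm), so
no `‖w‖₂²/ρ` enhancement; the only risk is bookkeeping of the `O(N²)`-many pair terms into `N·ρ·∫w`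
(needs `∑_{i≠j} L⁻³ = N(N−1)/L³ ≤ Nρ`), which is routine. Leans on: as S2 + `le_periodizedPotential`,
`volume_cell`, Fubini on the cell; `LSSY2005_upperBound_periodic_holds` not needed (Hartree bound suffices). -/
def PhaseDoubleCommutator : Prop :=
  ∀ R₀ V₁ : ℝ, 0 < R₀ → 0 ≤ V₁ → ∀ κ : ℝ, 0 < κ →
    ∃ ρ₀ : ℝ, 0 < ρ₀ ∧ ∃ C : ℝ, 0 < C ∧ ∀ ρ : ℝ, 0 < ρ → ρ < ρ₀ → ∀ᶠ N : ℕ in atTop,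
      ∀ w : ℝ → ℝ≥0∞, InClass R₀ V₁ w →
        periodicGroundStateEnergy w N (sideLength ρ N) ≠ ⊤ →
        ∀ k : Fin 3 → ℤ, InWindow κ ρ N k → ∀ ε : ℝ, 0 < ε → ∃ δ : ℝ≥0∞, 0 < δ ∧
          ∀ Ψ : PeriodicTrialState N (sideLength ρ N), NearMin w ρ N δ Ψ →
            energyForm w (sideLength ρ N) (periodicGroundStateEnergy w N (sideLength ρ N)).toReal
                (phaseUp (sideLength ρ N) k Ψ.ψ) ≤
              C * N * (‖waveVec (sideLength ρ N) k‖ ^ 2 + ρ) + ε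

/-- **S4 — CONDENSATE DENSITY QUADRATURE IS NOT ENHANCED (L–XL; registered
`stub_condensateDensityQuadrature`).** Uniformly over `𝒱(R₀,V₁)`: `‖P_kΨ‖² ≤ C·N + ε` for
`δ`-near-minimisers and window modes (`C = C(R₀,V₁,κ)`). Bogoliubov: `N₀(u_k−v_k)² = N₀‖k̃‖/√(‖k̃‖²+2B) ≤ N₀`;
free gas: `= N` exactly. INTENDED PROOF (the card's mirror pencil, corrected by triage power counting): the
second cone block `{P_kΨ, U_kΨ}` gives `(Re⟨P_kΨ,(H−E₀)U_kΨ⟩)² ≤ Q(P_kΨ)·Q(U_kΨ) ≤ C²N²(‖k̃‖²+ρ)²`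
(`Q(P_kΨ) ≤ CN(‖k̃‖²+ρ)` exactly as S3; its true size `N₀(‖k̃‖²+G)`, `G ≈ 2ρ(‖w‖₁−8πa) ≥ 0`, triage r1-3
Appendix (F1)–(F3), is harmless here), while `[T, U_k] = ‖k̃‖²P_k` makes the mixed entry
`‖k̃‖²‖P_kΨ‖² + Re⟨P_kΨ, [V,U_k]Ψ⟩`; the LOAD is the renormalised mean-field identification
`Re⟨P_kΨ,[V,U_k]Ψ⟩ ≥ 2B_r‖P_kΨ‖² − C′ρ√N‖P_kΨ‖ − C′ρN` with `B_r ≥ cρ` (`c = c(R₀,V₁) > 0` for `∫w > 0`;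
mean-field sign: `[V₂, a_k† − a₋ₖ] = +2B(a_k† + a₋ₖ)`, a POSITIVE mass for the density quadrature), after
which `(‖k̃‖² + 2B_r)‖P‖² ≤ CN(‖k̃‖²+ρ) + …` is a quadratic inequality giving `‖P_kΨ‖² ≤ C(κ)N` on the
window (`‖k̃‖² ≤ 12π²κ²ρ`). For `∫w = 0` the claim is the free one. NOTE (triage): the card's (B3) as a NORM
bound `‖([V,U_k] − 2B_rP_k)Ψ‖ ≤ CB_r√N` is FALSE by power counting (pair creation out of the condensate
gives `‖·‖ ≍ √(Nρ)‖w‖₂ ≫ ρ√N`); only the CORRELATION form above can hold. Why it might fail: the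
identification is an `O(1)`-precision statement about one interaction correlation in the condensate-leg
density channel; through `‖P_kΨ‖ ≥ ‖ρ_k†Ψ‖ − ‖ρ′_kΨ‖` it implies a BOUNDED STRUCTURE FACTOR `S(k) = O(1)` on
the window (no Bragg peak in the dilute ground state) — expected, not in print. Leans on: S3's toolkit;
`densityWave`/`structureFactorVar` (`BoseGasStructureFactor`) for the `S(k)` reading. -/
def CondensateDensityQuadrature : Prop :=
  ∀ R₀ V₁ : ℝ, 0 < R₀ → 0 ≤ V₁ → ∀ κ : ℝ, 0 < κ →
    ∃ ρ₀ : ℝ, 0 < ρ₀ ∧ ∃ C : ℝ, 0 < C ∧ ∀ ρ : ℝ, 0 < ρ → ρ < ρ₀ → ∀ᶠ N : ℕ in atTop,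
      ∀ w : ℝ → ℝ≥0∞, InClass R₀ V₁ w →
        periodicGroundStateEnergy w N (sideLength ρ N) ≠ ⊤ →
        ∀ k : Fin 3 → ℤ, InWindow κ ρ N k → ∀ ε : ℝ, 0 < ε → ∃ δ : ℝ≥0∞, 0 < δ ∧
          ∀ Ψ : PeriodicTrialState N (sideLength ρ N), NearMin w ρ N δ Ψ →
            cellNormSq (sideLength ρ N) (condUp (sideLength ρ N) k Ψ.ψ) ≤ C * N + ε

/-- **S5a (per class) — CONDENSATE-NUMBER VARIANCE / NO CAT (XL, open; registered through
`CondensateNumberVariance` as `stub_condensateNumberVariance`).** Uniformly over `𝒱(R₀,V₁)`: for `ρ < ρ₀`,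
eventually in `N`, some `δ > 0`: every `δ`-near-minimiser has `Var_Ψ(n̂₀) = ‖n̂₀Ψ‖² − ⟨Ψ,n̂₀Ψ⟩² ≤ C·N`,
where `n̂₀Ψ = transfer L 0 0 Ψ = ∑ᵢ L⁻³∫_cell Ψ(X[i↦y])dy` and `⟨Ψ,n̂₀Ψ⟩ = n₀(Ψ)` (the tree's
`cellOccupation N L (planeWaveMode L 0)`, as a real). Bogoliubov: `2√π√(ρa³)·N` (IR-finite `∫d³k/k²`
exactly in `d = 3`); free gas `0`. WHY THE LINE NEEDS IT (triage r1-1/2 on the card's (B4)): every generator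
with a condensate leg is blind to the sector `n₀ ≪ N`; the weighted bounds of S1–S4 constrain
`E[n₀(N−n₀)]` only, which a CAT (superposition of a condensed and an uncondensed state) satisfies
trivially, and coupling continuity alone does not exclude a continuously rotating cat — a second-moment
(no-cat) input is necessary for ANY condensate-leg certificate. Why it might fail / status: open in the
thermodynamic box (proved in GP/mean-field scalings only: LNSS `arXiv:1211.2778`, Boccato–Brennecke–
Cenatiempo–Schlein); sibling obligation `BECNudgeWalk.CondensateVariance` (stmt-14360; Dirichlet,
nudged, conditional on condensation) — pool the work. The bootstrap uses exactly `Var ≤ CN`: it enters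
as the additive error `N·P(n₀ < N/2) ≤ 9C`, which the top of the window (`√ρL/‖k‖_∞ ≥ 1/κ`) absorbs; an
anomalous `Var ≍ N^{4/3}` (GPS 1998-type; none expected at `T = 0` in `d = 3`) would NOT suffice. -/
def CondensateNumberVarianceClass (R₀ V₁ : ℝ) : Prop :=
  ∃ ρ₀ : ℝ, 0 < ρ₀ ∧ ∃ C : ℝ, 0 < C ∧ ∀ ρ : ℝ, 0 < ρ → ρ < ρ₀ → ∀ᶠ N : ℕ in atTop,
    ∀ w : ℝ → ℝ≥0∞, InClass R₀ V₁ w →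
      periodicGroundStateEnergy w N (sideLength ρ N) ≠ ⊤ →
      ∃ δ : ℝ≥0∞, 0 < δ ∧ ∀ Ψ : PeriodicTrialState N (sideLength ρ N), NearMin w ρ N δ Ψ →
        cellNormSq (sideLength ρ N) (transfer (sideLength ρ N) 0 0 Ψ.ψ) ≤
          cellInnerRe (sideLength ρ N) Ψ.ψ (transfer (sideLength ρ N) 0 0 Ψ.ψ) ^ 2 + C * N

/-- **S5a — `CondensateNumberVarianceClass` for every class** (registered `stub_condensateNumberVariance`). -/
def CondensateNumberVariance : Prop :=
  ∀ R₀ V₁ : ℝ, 0 < R₀ → 0 ≤ V₁ → CondensateNumberVarianceClass R₀ V₁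

/-- **The n₀-WEIGHTED infrared bound for a class** (the OUTPUT of S1–S4, proved below in
`weightedClassBound_of`; the INPUT of S5): uniformly over `𝒱(R₀,V₁)`, for every window `κ` there are
`ρ₀, C` with: `ρ < ρ₀`, eventually in `N`, every window mode, some `δ > 0`, every `δ`-near-minimiser:
`‖U_kΨ‖² + ‖P_kΨ‖² ≤ C·N·√ρ L_N/‖k‖_∞`, i.e. (parallelogram law) `⟨n₀ n_k⟩_Ψ + ⟨(n₀+1)n₋ₖ⟩_Ψ ≤ ½C N√ρL/‖k‖_∞`. -/
def WeightedClassBound (R₀ V₁ : ℝ) : Prop :=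
  ∀ κ : ℝ, 0 < κ → ∃ ρ₀ : ℝ, 0 < ρ₀ ∧ ∃ C : ℝ, 0 < C ∧ ∀ ρ : ℝ, 0 < ρ → ρ < ρ₀ → ∀ᶠ N : ℕ in atTop,
    ∀ w : ℝ → ℝ≥0∞, InClass R₀ V₁ w →
      periodicGroundStateEnergy w N (sideLength ρ N) ≠ ⊤ →
      ∀ k : Fin 3 → ℤ, InWindow κ ρ N k → ∃ δ : ℝ≥0∞, 0 < δ ∧
        ∀ Ψ : PeriodicTrialState N (sideLength ρ N), NearMin w ρ N δ Ψ →
          cellNormSq (sideLength ρ N) (phaseUp (sideLength ρ N) k Ψ.ψ) +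
              cellNormSq (sideLength ρ N) (condUp (sideLength ρ N) k Ψ.ψ) ≤
            C * N * Real.sqrt ρ * sideLength ρ N / ‖(fun j => (k j : ℝ))‖

/-- **S5 — NORMALISATION BOOTSTRAP (L; registered `stub_normalisationBootstrap`).** For every class:
no-cat (S5a on the class) + the weighted class bound (all windows `κ`) ⇒ `IRBoundFor w` for every `w` of
the class. INTENDED PROOF (triage r1-2 §P4, `δ` after `N` throughout, all at fixed `(N, L)`): (1) kinematics:
`‖U_kΨ‖² + ‖P_kΨ‖² = 2⟨n₀(n_k+1)⟩ + 2⟨n₋ₖ(n₀+1)⟩ ≥ 2⟨n₀n_k⟩` for the commuting occupation operators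
`n̂_q = dΓ(|φ_q⟩⟨φ_q|)` (spectra `⊂ {0,…,N}`, joint spectral measure = "law of `(n₀, n_k)`"); (2) weighted
mode counting on a window `κ′ ≥ κ`: `∑_{0<‖k‖_∞≤K} 1/‖k‖_∞ ≤ 12K² + 2` gives
`∑_{window} ⟨n₀n_k⟩ ≤ 6Cκ′²√ρ·N² ≤ N²/16` for `ρ` small, and the UV tail by Parseval/Markov
(`cellOccupation_le_energy_div`, landed): `∑_{‖k‖_∞>κ′√ρL} n_k ≤ ⟨Ψ,TΨ⟩/(4π²κ′²ρ) ≤ N V₁/(8π²κ′²) + δ/… ≤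
N/16` for `κ′² ≥ 2V₁/π²` (Hartree bound `⟨Ψ,HΨ⟩ ≤ ½NρV₁ + δ`), whence `E[n₀(N−n₀)] ≤ N²/8`; (3) with
`x = E n₀/N` and S5a: `x(1−x) ≤ 1/8 + C_V/N`, so `x ∉ (0.16, 0.84)` for `N` large — for EVERY coupling
`λ ∈ [0,1]` (`λw ∈ 𝒱(R₀,V₁)`, same `ρ₀, C`, same `N`-threshold: this is why the stubs are class-uniform);
(4) coupling continuity at fixed `(N, L)`: `λ ↦ x_λ` is continuous on `[0,1]` with `x₀ = 1` (unique
positive ground state of `T + λV`, Perron–Frobenius; monotone/analytic form perturbation, Kato–Simon),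
hence `x ≥ 0.84` at `λ = 1`; (5) Chebyshev: `P(n₀ < N/2) ≤ Var/(0.34N)² ≤ 9C_V/N`, so
`n_k = E[n_k 1_{n₀≥N/2}] + E[n_k 1_{n₀<N/2}] ≤ (2/N)E[n₀n_k] + N·P(n₀<N/2) ≤ C√ρL/‖k‖_∞ + 9C_V ≤
(C + 9C_Vκ)√ρL/‖k‖_∞`; (6) `δ`-bookkeeping into `IRBoundFor` (`∃δ ∀Ψ ∀k`: least slack over the finite
window, `Negative.inWindow_mem_box`, `irBoundWith_of_ground`). Why it might fail: not through (1)–(3),(5),(6)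
(kinematics/arithmetic); (4) needs the near-minimiser ⇄ ground-state dictionary at fixed `(N, L)` (compact
resolvent, simple ground state, `C¹` core) — standard but not in the tree (shared FA debt with
`linear-ph-floor-wagner`'s `ZeroMomentumGround` and the `stub_nearMinimiserFrame`-type stubs of other lines).
Leans on: `tsum_cellOccupation_planeWaveMode_eq` (`∑_k n_k = N`), `cellOccupation_le_energy_div`,
`fracDispersion_mul_cellOccupation_le` (UV Markov), `irBoundWith_of_ground`, `inWindow_mem_box`,
`eventually_one_le_window` (landed `Negative.*`), `natCast_le_condensateOccupation_add`. -/
def NormalisationBootstrap : Prop :=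
  ∀ R₀ V₁ : ℝ, 0 < R₀ → 0 ≤ V₁ →
    CondensateNumberVarianceClass R₀ V₁ → WeightedClassBound R₀ V₁ →
      ∀ w : ℝ → ℝ≥0∞, InClass R₀ V₁ w → IRBoundFor w

/-- **S6 — THE NON-INTEGRABLE HALF (XL; registered `stub_nonIntegrableHalf`; NOT REDUCED by this
skeleton).** `IRBoundFor v` for admissible `v` with `∫v(|x|)dx = ∞` (hard cores, non-`L¹` cores), which the
crux demands verbatim (`Disproof §19 hardCore_in_scope`, `periodicIRBound_iff_split`). The undressed pencil is
void there (`Q(U_kΨ) = +∞`: `U_kΨ` does not vanish on the cores) and its constants grow with `∫v`, so no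
truncation `min(v,t) ↑ v` with `t`-uniform constants is available from S1–S5. INTENDED PROOF: the DRESSED
pencil — replace `U_k, P_k` by `Ũ_k = ∑ⱼ (∏_{l≠j} f(xⱼ−x_l))·𝔭ⱼ` with `f` the zero-energy scattering solution
cut at `a ≪ R ≪ ρ^{-1/3}` (`PeriodicBoseGasScattering*`), rerun S1–S5 with `B ↦ 8πρa` and dressing errors
`O(√(ρR³))` (`[T, Ũ_k] = ‖k̃‖²P̃_k +` a two-body term of relative size `O(ρa³)^{1/2}`; three-body terms in
the double commutators); the f-sum entry and the purely kinetic mixed entry are UNCHANGED (`ρ_k†` commutes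
with the Jastrow factor). Shared debt with stmt-AtomisticToContinuum-11844 `BECNoCheapMomentum.HardCoreMomentBound`
(same dressing, same `|n₀ − ñ₀| ≤ CN(ρR³)^{1/2}` control) and GDTransfer's card `dyson-dressed-witness`.
Recommendation to the route planner: promote to a route item / pool with 11844 rather than staff it under
this line. Why it might fail: only with the crux itself (it IS the crux on a sub-class). -/
def NonIntegrableHalf : Prop :=
  ∀ v : ℝ → ℝ≥0∞, IsRepulsiveFiniteRange v → (∫⁻ x : Space, v ‖x‖) = ⊤ → IRBoundFor v

/-- **Typed alternative for S1 (not registered): the STATIC backflow-current bound** `‖R_kΨ‖² ≤ C N ‖k̃‖⁴ + ε`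
— implies `BackflowBound` by Cauchy–Schwarz on the cell (`|Re⟨U_kΨ,R_kΨ⟩| ≤ ‖U_kΨ‖‖R_kΨ‖`). The lead may
re-register S1 in this form (one edit: `theorem stub_backflowBound : StaticBackflowCurrent := by sorry` plus
the Cauchy–Schwarz line in `weightedClassBound_of`). -/
def StaticBackflowCurrent : Prop :=
  ∀ R₀ V₁ : ℝ, 0 < R₀ → 0 ≤ V₁ → ∀ κ : ℝ, 0 < κ →
    ∃ ρ₀ : ℝ, 0 < ρ₀ ∧ ∃ C : ℝ, 0 < C ∧ ∀ ρ : ℝ, 0 < ρ → ρ < ρ₀ → ∀ᶠ N : ℕ in atTop,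
      ∀ w : ℝ → ℝ≥0∞, InClass R₀ V₁ w →
        periodicGroundStateEnergy w N (sideLength ρ N) ≠ ⊤ →
        ∀ k : Fin 3 → ℤ, InWindow κ ρ N k → ∀ ε : ℝ, 0 < ε → ∃ δ : ℝ≥0∞, 0 < δ ∧
          ∀ Ψ : PeriodicTrialState N (sideLength ρ N), NearMin w ρ N δ Ψ →
            cellNormSq (sideLength ρ N) (fun X => kinCommutator (sideLength ρ N) k Ψ.ψ X -
                (((‖waveVec (sideLength ρ N) k‖ ^ 2 : ℝ)) : ℂ) * phaseUp (sideLength ρ N) k Ψ.ψ X) ≤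
              C * N * ‖waveVec (sideLength ρ N) k‖ ^ 4 + ε

/-! ## Audit names of the stub statements

`Goal.stub_x` abbreviates the statement of the registered stub `stub_x`, so that the skeleton audit
(`#h21_check_skeleton`, by-name policy on hypothesis heads) reads the hypotheses of `PeriodicIRBound_of` as
exactly the seven declared stubs. -/

namespace Goal

/-- Statement of S1 `stub_backflowBound`. -/
abbrev stub_backflowBound : Prop := BackflowBound
/-- Statement of S2 `stub_phaseConeBlock`. -/
abbrev stub_phaseConeBlock : Prop := PhaseConeBlock
/-- Statement of S3 `stub_phaseDoubleCommutator`. -/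
abbrev stub_phaseDoubleCommutator : Prop := PhaseDoubleCommutator
/-- Statement of S4 `stub_condensateDensityQuadrature`. -/
abbrev stub_condensateDensityQuadrature : Prop := CondensateDensityQuadrature
/-- Statement of S5a `stub_condensateNumberVariance`. -/
abbrev stub_condensateNumberVariance : Prop := CondensateNumberVariance
/-- Statement of S5 `stub_normalisationBootstrap`. -/
abbrev stub_normalisationBootstrap : Prop := NormalisationBootstrap
/-- Statement of S6 `stub_nonIntegrableHalf`. -/
abbrev stub_nonIntegrableHalf : Prop := NonIntegrableHalf

end Goal

/-! ## Registered stubs (the only `sorry`s of this file) -/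

/-- S1 (XL, hardest) — see `BackflowBound`. -/
theorem stub_backflowBound : BackflowBound := by
  sorry

/-- S2 (M–L, provable now) — see `PhaseConeBlock`. -/
theorem stub_phaseConeBlock : PhaseConeBlock := by
  sorry

/-- S3 (M–L) — see `PhaseDoubleCommutator`. -/
theorem stub_phaseDoubleCommutator : PhaseDoubleCommutator := by
  sorry

/-- S4 (L–XL) — see `CondensateDensityQuadrature`. -/
theorem stub_condensateDensityQuadrature : CondensateDensityQuadrature := by
  sorry

/-- S5a (XL, open no-cat) — see `CondensateNumberVariance`. -/
theorem stub_condensateNumberVariance : CondensateNumberVariance := by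
  sorry

/-- S5 (L) — see `NormalisationBootstrap`. -/
theorem stub_normalisationBootstrap : NormalisationBootstrap := by
  sorry

/-- S6 (XL, not reduced) — see `NonIntegrableHalf`. -/
theorem stub_nonIntegrableHalf : NonIntegrableHalf := by
  sorry

/-! ## Sorry-free lemmas for the composition -/

section Lemmas

variable {N : ℕ}

/-- `‖f‖²_cell ≥ 0`. -/
theorem cellNormSq_nonneg (L : ℝ) (f : Config N → ℂ) : 0 ≤ cellNormSq L f :=
  integral_nonneg fun _ => by positivity

/-- Monotonicity of the near-minimiser property in the slack. -/
theorem nearMin_mono {w : ℝ → ℝ≥0∞} {ρ : ℝ} {δ δ' : ℝ≥0∞} {Ψ : PeriodicTrialState N (sideLength ρ N)}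
    (h : NearMin w ρ N δ Ψ) (hδ : δ ≤ δ') : NearMin w ρ N δ' Ψ :=
  le_trans (show periodicEnergy w Ψ ≤ _ from h) (add_le_add le_rfl hδ)

/-- Quadratic inequality: `a y² ≤ b y + c` with `a > 0` gives `y² ≤ (b/a)² + 2c/a`. [folklore] -/
theorem sq_le_of_quadratic {a b c y : ℝ} (ha : 0 < a) (h : a * y ^ 2 ≤ b * y + c) :
    y ^ 2 ≤ (b / a) ^ 2 + 2 * c / a := by
  have h1 : a ^ 2 * y ^ 2 ≤ b ^ 2 + 2 * a * c := by
    nlinarith [sq_nonneg (a * y - b), mul_le_mul_of_nonneg_left h ha.le]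
  rw [div_pow, div_add_div _ _ (pow_ne_zero 2 ha.ne') ha.ne', le_div_iff₀ (by positivity)]
  nlinarith [h1, ha]

/-- The sup norm of an integer vector is at most its Euclidean norm. [folklore] -/
theorem norm_intVec_le_norm_latticeVec (k : Fin 3 → ℤ) :
    ‖(fun j => (k j : ℝ))‖ ≤ ‖latticeVec 1 k‖ := by
  refine (pi_norm_le_iff_of_nonneg (norm_nonneg _)).2 fun j => ?_
  rw [EuclideanSpace.norm_eq]
  refine Real.le_sqrt_of_sq_le ?_
  have : ‖(k j : ℝ)‖ ^ 2 = ‖(latticeVec 1 k) j‖ ^ 2 := by simp [latticeVec]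
  rw [this]
  exact Finset.single_le_sum (f := fun i => ‖(latticeVec 1 k) i‖ ^ 2) (fun i _ => by positivity)
    (Finset.mem_univ j)

/-- `‖k̃‖ = (2π/L)·|k|₂`. [folklore] -/
theorem norm_waveVec {L : ℝ} (hL : 0 < L) (k : Fin 3 → ℤ) :
    ‖waveVec L k‖ = 2 * Real.pi / L * ‖latticeVec 1 k‖ := by
  rw [waveVec, norm_smul, Real.norm_of_nonneg (by positivity)]

theorem latticeVec_one_ne_zero {k : Fin 3 → ℤ} (hk : k ≠ 0) : latticeVec 1 k ≠ 0 := by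
  intro h
  apply hk
  funext j
  have := congrArg (fun x : Space => x j) h
  simpa [latticeVec] using this

/-- `k ≠ 0 ⇒ ‖k̃‖ > 0`. [folklore] -/
theorem norm_waveVec_pos {L : ℝ} (hL : 0 < L) {k : Fin 3 → ℤ} (hk : k ≠ 0) : 0 < ‖waveVec L k‖ := by
  rw [norm_waveVec hL]
  exact mul_pos (by positivity) (norm_pos_iff.2 (latticeVec_one_ne_zero hk))

/-- The window conversion `2π‖k‖_∞/L ≤ ‖k̃‖`. [folklore] -/
theorem two_pi_mul_norm_div_le_norm_waveVec {L : ℝ} (hL : 0 < L) (k : Fin 3 → ℤ) :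
    2 * Real.pi * ‖(fun j => (k j : ℝ))‖ / L ≤ ‖waveVec L k‖ := by
  rw [norm_waveVec hL, mul_div_right_comm]
  exact mul_le_mul_of_nonneg_left (norm_intVec_le_norm_latticeVec k) (by positivity)

/-- **The composition algebra** (the card's `PhaseExtraction`, sharpened: a quadratic inequality in
`y = ‖U_kΨ‖` absorbs the backflow term carrying `y`; all defect allowances already substituted).
Inputs: S1 with `ε₁ = N√ρ‖k̃‖` (`h1`), S2 with `ε₂ = N‖k̃‖²` (`h2`), S3 with `ε₃ = Nρ` (`h3`), S4 with
`ε₄ = N` (`h4`), the two window conversions. Output: `‖U‖² + ‖P‖² ≤ C_w N√ρL/‖k‖_∞` with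
`C_w = (2C₁² + 2√(3(C₃+1)) + 3 + C₄)κ + (2√(3(C₃+1)) + 2C₁ + 2)/(2π)`. [folklore] -/
theorem weighted_algebra {N ρ kk L kinf κ C₁ C₃ C₄ μ nu np Q : ℝ}
    (hN : 1 ≤ N) (hρ : 0 < ρ) (hkk : 0 < kk) (hL : 0 < L) (hkinf : 0 < kinf) (hκ : 0 < κ)
    (hC₁ : 0 < C₁) (hC₃ : 0 < C₃) (hC₄ : 0 < C₄) (hnu : 0 ≤ nu)
    (hwin1 : kinf ≤ κ * Real.sqrt ρ * L)
    (hwin2 : 2 * Real.pi * kinf / L ≤ kk)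
    (h1 : |μ - kk ^ 2 * nu| ≤
      C₁ * (N * Real.sqrt ρ * kk + Real.sqrt N * kk ^ 2 * Real.sqrt nu) + N * Real.sqrt ρ * kk)
    (h2 : |μ| ≤ Real.sqrt (Q * (2 * N * kk ^ 2 + N * kk ^ 2)) + N * kk ^ 2)
    (h3 : Q ≤ C₃ * N * (kk ^ 2 + ρ) + N * ρ)
    (h4 : np ≤ C₄ * N + N) :
    nu + np ≤ ((2 * C₁ ^ 2 + 2 * Real.sqrt (3 * (C₃ + 1)) + 3 + C₄) * κ +
        (2 * Real.sqrt (3 * (C₃ + 1)) + 2 * C₁ + 2) / (2 * Real.pi)) * N * Real.sqrt ρ * L / kinf := by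
  set A : ℝ := Real.sqrt (3 * (C₃ + 1)) with hA_def
  have hA : 0 ≤ A := Real.sqrt_nonneg _
  have hNpos : 0 < N := by linarith
  have hsρ : 0 < Real.sqrt ρ := Real.sqrt_pos.2 hρ
  have hsN : 0 < Real.sqrt N := Real.sqrt_pos.2 hNpos
  -- step 1: the square root in h2
  have hsqrt : Real.sqrt (Q * (2 * N * kk ^ 2 + N * kk ^ 2)) ≤ A * N * kk * (kk + Real.sqrt ρ) := by
    have h3' : Q * (2 * N * kk ^ 2 + N * kk ^ 2) ≤ (A * N * kk * (kk + Real.sqrt ρ)) ^ 2 := by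
      have hpos : 0 ≤ 2 * N * kk ^ 2 + N * kk ^ 2 := by positivity
      have := mul_le_mul_of_nonneg_right h3 hpos
      have hA2 : A ^ 2 = 3 * (C₃ + 1) := by
        rw [hA_def, Real.sq_sqrt (by positivity)]
      have hρ2 : Real.sqrt ρ ^ 2 = ρ := Real.sq_sqrt hρ.le
      have hstep1 : (C₃ * N * (kk ^ 2 + ρ) + N * ρ) * (2 * N * kk ^ 2 + N * kk ^ 2) ≤
          3 * (C₃ + 1) * N ^ 2 * kk ^ 2 * (kk ^ 2 + ρ) := by
        have : (C₃ * N * (kk ^ 2 + ρ) + N * ρ) ≤ (C₃ + 1) * N * (kk ^ 2 + ρ) := by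
          nlinarith [mul_nonneg hNpos.le (sq_nonneg kk)]
        nlinarith [this, hpos]
      have hstep2 : kk ^ 2 + ρ ≤ (kk + Real.sqrt ρ) ^ 2 := by
        nlinarith [hρ2, mul_nonneg hkk.le hsρ.le]
      have hstep3 : 3 * (C₃ + 1) * N ^ 2 * kk ^ 2 * (kk ^ 2 + ρ) ≤
          3 * (C₃ + 1) * N ^ 2 * kk ^ 2 * (kk + Real.sqrt ρ) ^ 2 :=
        mul_le_mul_of_nonneg_left hstep2 (by positivity)
      have hsq : (A * N * kk * (kk + Real.sqrt ρ)) ^ 2 =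
          3 * (C₃ + 1) * N ^ 2 * kk ^ 2 * (kk + Real.sqrt ρ) ^ 2 := by
        rw [show (A * N * kk * (kk + Real.sqrt ρ)) ^ 2 = A ^ 2 * N ^ 2 * kk ^ 2 * (kk + Real.sqrt ρ) ^ 2
          by ring, hA2]
      rw [hsq]
      exact this.trans (hstep1.trans hstep3)
    calc Real.sqrt (Q * (2 * N * kk ^ 2 + N * kk ^ 2))
        ≤ Real.sqrt ((A * N * kk * (kk + Real.sqrt ρ)) ^ 2) := Real.sqrt_le_sqrt h3'
      _ = A * N * kk * (kk + Real.sqrt ρ) := Real.sqrt_sq (by positivity)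
  -- step 2: kk² nu ≤ b y + c with y = √nu
  set y : ℝ := Real.sqrt nu with hy_def
  have hy : 0 ≤ y := Real.sqrt_nonneg _
  have hy2 : y ^ 2 = nu := Real.sq_sqrt hnu
  set G : ℝ := A * N * kk * (kk + Real.sqrt ρ) + N * kk ^ 2 + (C₁ + 1) * (N * Real.sqrt ρ * kk)
    with hG_def
  have hG : 0 ≤ G := by positivity
  have hquad : kk ^ 2 * y ^ 2 ≤ (C₁ * Real.sqrt N * kk ^ 2) * y + G := by
    have habs : kk ^ 2 * nu ≤ |μ| + |μ - kk ^ 2 * nu| := by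
      linarith [le_abs_self μ, neg_le_abs (μ - kk ^ 2 * nu)]
    rw [hy2]
    nlinarith [habs, h1, h2, hsqrt]
  have hysq := sq_le_of_quadratic (by positivity : 0 < kk ^ 2) hquad
  -- y² ≤ (C₁√N)² + 2G/kk²
  have hnu_le : nu ≤ C₁ ^ 2 * N + 2 * G / kk ^ 2 := by
    rw [← hy2]
    have : (C₁ * Real.sqrt N * kk ^ 2 / kk ^ 2) ^ 2 = C₁ ^ 2 * N := by
      rw [mul_div_assoc, div_self (pow_ne_zero 2 hkk.ne'), mul_one, mul_pow, Real.sq_sqrt hNpos.le]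
    rw [this] at hysq
    exact hysq
  -- step 3: window conversions
  have hconv1 : (1 : ℝ) ≤ κ * Real.sqrt ρ * L / kinf := by
    rw [le_div_iff₀ hkinf, one_mul]; exact hwin1
  have hconv2 : Real.sqrt ρ / kk ≤ Real.sqrt ρ * L / (2 * Real.pi * kinf) := by
    rw [div_le_div_iff₀ hkk (by positivity)]
    calc Real.sqrt ρ * (2 * Real.pi * kinf) = Real.sqrt ρ * (2 * Real.pi * kinf / L) * L := by
          field_simp
      _ ≤ Real.sqrt ρ * kk * L := by gcongr
      _ = Real.sqrt ρ * L * kk := by ring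
  -- step 4: assemble
  have hGdiv : 2 * G / kk ^ 2 = 2 * A * N + 2 * N + (2 * A + 2 * C₁ + 2) * N * (Real.sqrt ρ / kk) := by
    rw [hG_def]; field_simp; ring
  have hfinal : nu + np ≤ (2 * C₁ ^ 2 + 2 * A + 3 + C₄) * N * 1 +
      (2 * A + 2 * C₁ + 2) * N * (Real.sqrt ρ * L / (2 * Real.pi * kinf)) := by
    have hc : (2 * A + 2 * C₁ + 2) * N * (Real.sqrt ρ / kk) ≤
        (2 * A + 2 * C₁ + 2) * N * (Real.sqrt ρ * L / (2 * Real.pi * kinf)) :=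
      mul_le_mul_of_nonneg_left hconv2 (by positivity)
    have hC1N : 0 ≤ C₁ ^ 2 * N := by positivity
    have hAN : 0 ≤ A * N := by positivity
    rw [hGdiv] at hnu_le
    linarith [hnu_le, h4, hc, hC1N, hAN]
  have hone : (2 * C₁ ^ 2 + 2 * A + 3 + C₄) * N * 1 ≤
      (2 * C₁ ^ 2 + 2 * A + 3 + C₄) * N * (κ * Real.sqrt ρ * L / kinf) :=
    mul_le_mul_of_nonneg_left hconv1 (by positivity)
  calc nu + np ≤ (2 * C₁ ^ 2 + 2 * A + 3 + C₄) * N * (κ * Real.sqrt ρ * L / kinf) +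
        (2 * A + 2 * C₁ + 2) * N * (Real.sqrt ρ * L / (2 * Real.pi * kinf)) := by linarith
    _ = ((2 * C₁ ^ 2 + 2 * A + 3 + C₄) * κ + (2 * A + 2 * C₁ + 2) / (2 * Real.pi)) * N *
          Real.sqrt ρ * L / kinf := by
        field_simp

end Lemmas

/-! ## Composition I (sorry-free): S1–S4 ⇒ the weighted class bound -/

/-- **S1 ∧ S2 ∧ S3 ∧ S4 ⇒ `WeightedClassBound R₀ V₁`** for every class: intersect the eventual ranges,
choose the defect allowances proportional to positive `N`-dependent scales, take the least of the four slacks,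
and run `weighted_algebra`. [folklore] -/
theorem weightedClassBound_of (h1 : BackflowBound) (h2 : PhaseConeBlock) (h3 : PhaseDoubleCommutator)
    (h4 : CondensateDensityQuadrature) {R₀ V₁ : ℝ} (hR₀ : 0 < R₀) (hV₁ : 0 ≤ V₁) :
    WeightedClassBound R₀ V₁ := by
  intro κ hκ
  obtain ⟨ρ₁, hρ₁, C₁, hC₁, H1⟩ := h1 R₀ V₁ hR₀ hV₁ κ hκ
  obtain ⟨ρ₃, hρ₃, C₃, hC₃, H3⟩ := h3 R₀ V₁ hR₀ hV₁ κ hκ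
  obtain ⟨ρ₄, hρ₄, C₄, hC₄, H4⟩ := h4 R₀ V₁ hR₀ hV₁ κ hκ
  set Cw : ℝ := (2 * C₁ ^ 2 + 2 * Real.sqrt (3 * (C₃ + 1)) + 3 + C₄) * κ +
      (2 * Real.sqrt (3 * (C₃ + 1)) + 2 * C₁ + 2) / (2 * Real.pi) with hCw
  have hCwpos : 0 < Cw := by positivity
  refine ⟨min ρ₁ (min ρ₃ ρ₄), lt_min hρ₁ (lt_min hρ₃ hρ₄), Cw, hCwpos, fun ρ hρ hρlt => ?_⟩
  have hρ1 : ρ < ρ₁ := hρlt.trans_le (min_le_left _ _)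
  have hρ3 : ρ < ρ₃ := hρlt.trans_le ((min_le_right _ _).trans (min_le_left _ _))
  have hρ4 : ρ < ρ₄ := hρlt.trans_le ((min_le_right _ _).trans (min_le_right _ _))
  filter_upwards [H1 ρ hρ hρ1, H3 ρ hρ hρ3, H4 ρ hρ hρ4, eventually_gt_atTop 0] with N HN1 HN3 HN4 hNpos
  intro w hw hE k hk
  have hL : 0 < sideLength ρ N := sideLength_pos_of_pos hρ hNpos
  have hk0 : k ≠ 0 := hk.1
  have hkk : 0 < ‖waveVec (sideLength ρ N) k‖ := norm_waveVec_pos hL hk0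
  have hkinf : 0 < ‖(fun j => (k j : ℝ))‖ := lt_of_lt_of_le one_pos (one_le_norm_intVec hk0)
  have hwfr : IsRepulsiveFiniteRange w := ⟨hw.1, R₀, hw.2.1⟩
  have hwint : (∫⁻ x : Space, w ‖x‖) ≠ ⊤ := ne_top_of_le_ne_top ENNReal.ofReal_ne_top hw.2.2
  have hNr : (1 : ℝ) ≤ N := by exact_mod_cast hNpos
  have hNr' : (0 : ℝ) < N := by exact_mod_cast hNpos
  -- the four instances, with proportional defect allowances
  obtain ⟨δ₁, hδ₁, P1⟩ :=
    HN1 w hw hE k hk (N * Real.sqrt ρ * ‖waveVec (sideLength ρ N) k‖) (by positivity)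
  obtain ⟨δ₂, hδ₂, P2⟩ :=
    h2 w hwfr hwint N (sideLength ρ N) hL hE k hk0 (N * ‖waveVec (sideLength ρ N) k‖ ^ 2) (by positivity)
  obtain ⟨δ₃, hδ₃, P3⟩ := HN3 w hw hE k hk (N * ρ) (by positivity)
  obtain ⟨δ₄, hδ₄, P4⟩ := HN4 w hw hE k hk N hNr'
  refine ⟨min δ₁ (min δ₂ (min δ₃ δ₄)), lt_min hδ₁ (lt_min hδ₂ (lt_min hδ₃ hδ₄)), fun Ψ hΨ => ?_⟩
  have hΨ1 : NearMin w ρ N δ₁ Ψ := nearMin_mono hΨ (min_le_left _ _)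
  have hΨ2 : NearMin w ρ N δ₂ Ψ := nearMin_mono hΨ ((min_le_right _ _).trans (min_le_left _ _))
  have hΨ3 : NearMin w ρ N δ₃ Ψ :=
    nearMin_mono hΨ ((min_le_right _ _).trans ((min_le_right _ _).trans (min_le_left _ _)))
  have hΨ4 : NearMin w ρ N δ₄ Ψ :=
    nearMin_mono hΨ ((min_le_right _ _).trans ((min_le_right _ _).trans (min_le_right _ _)))
  exact weighted_algebra hNr hρ hkk hL hkinf hκ hC₁ hC₃ hC₄ (cellNormSq_nonneg _ _) hk.2
    (two_pi_mul_norm_div_le_norm_waveVec hL k) (P1 Ψ hΨ1) (P2 Ψ hΨ2) (P3 Ψ hΨ3) (P4 Ψ hΨ4)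

/-! ## Composition II (sorry-free): the crux BY NAME -/

/-- All seven named statements give `IRBoundFor v` for EVERY admissible `v`: split on `∫v = ∞` (S6);
otherwise `v ∈ 𝒱(max R 1, ∫v)` and S5 applies to the weighted class bound of S1–S4 and the no-cat input S5a.
[folklore] -/
theorem irBoundFor_all (h1 : BackflowBound) (h2 : PhaseConeBlock) (h3 : PhaseDoubleCommutator)
    (h4 : CondensateDensityQuadrature) (h5a : CondensateNumberVariance) (h5 : NormalisationBootstrap)
    (h6 : NonIntegrableHalf) :
    ∀ v : ℝ → ℝ≥0∞, IsRepulsiveFiniteRange v → IRBoundFor v := by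
  intro v hv
  by_cases htop : (∫⁻ x : Space, v ‖x‖) = ⊤
  · exact h6 v hv htop
  · obtain ⟨R, hR⟩ := hv.2
    have hR₀ : (0 : ℝ) < max R 1 := lt_max_of_lt_right one_pos
    have hV₁ : (0 : ℝ) ≤ (∫⁻ x : Space, v ‖x‖).toReal := ENNReal.toReal_nonneg
    have hcls : InClass (max R 1) (∫⁻ x : Space, v ‖x‖).toReal v :=
      ⟨hv.1, fun r hr => hR r ((le_max_left _ _).trans_lt hr), by rw [ENNReal.ofReal_toReal htop]⟩
    exact h5 _ _ hR₀ hV₁ (h5a _ _ hR₀ hV₁) (weightedClassBound_of h1 h2 h3 h4 hR₀ hV₁) v hcls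

/-- **`PeriodicIRBound` from the seven registered stubs** (glue shape: hypotheses = the stubs by name,
conclusion = the route decl by name; the body is `Negative.periodicIRBound_iff` + `irBoundFor_all`). [folklore] -/
theorem PeriodicIRBound_of (h1 : Goal.stub_backflowBound) (h2 : Goal.stub_phaseConeBlock)
    (h3 : Goal.stub_phaseDoubleCommutator) (h4 : Goal.stub_condensateDensityQuadrature)
    (h5a : Goal.stub_condensateNumberVariance) (h5 : Goal.stub_normalisationBootstrap)
    (h6 : Goal.stub_nonIntegrableHalf) : PeriodicIRBound :=
  periodicIRBound_iff.mpr (irBoundFor_all h1 h2 h3 h4 h5a h5 h6)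

/-- The skeleton applied to the (sorried) stubs: `PeriodicIRBound` modulo exactly S1–S6. -/
theorem PeriodicIRBound_proof : PeriodicIRBound :=
  PeriodicIRBound_of stub_backflowBound stub_phaseConeBlock stub_phaseDoubleCommutator
    stub_condensateDensityQuadrature stub_condensateNumberVariance stub_normalisationBootstrap
    stub_nonIntegrableHalf

end Summit.AtomisticToContinuum.BoseEinsteinCondensation.Cruxes.PeriodicIRBound.FsumPhasePencil

end
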